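import Summits.Ventures.YMGap.Census.OddCrossingBound
import Summits.Ventures.YMGap.Census.MarkedPlaquetteTransport
import HarnessLib

/-!
# Venture YMGap, track (b) — Tomboulis's Prop. IV.1 `|Z⁻_Λ| ≤ Z_Λ` and the marked-plaquette positivity on the
# ODD torus, on the positivity domain `f_c ≥ 0`

HONEST FRAMING: venture file of the cell `pub-ymgap` (QuantumFields programme), track (b); finite-volume lattice
gauge theory only — E. T. Tomboulis, arXiv:0707.2179, Prop. IV.1 eq. (4.6) (`Z⁻ ≤ Z`), §4.1 eq. (4.7) (`-Z ≤ Z⁻`),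
and the positivity `∫ d_k χ_k(U_{p₀}) ∏_{p ≠ p₀} f(U_p) dU ≥ 0` behind Prop. II.1 (i) — now on the ODD periodic
lattice `(ℤ/Lℤ)^d` (`L = 2m+1 ≥ 3`, e.g. the census's `3³`), where the reflection has one hyperplane through sites
and the printed "reflection positivity in planes with sites" (§2 after (2.8)) is used.  Its price, made explicit:
besides `c_j ≥ 0` the plaquette function must be POINTWISE non-negative, `∀ U, 0 ≤ f_c(U)` (true for Tomboulis's
`f = e^{A_p}/F_0`; on the one-character ray `f = 1 + 2 c_{1/2} χ_{1/2}` iff `c_{1/2} ≤ 1/4`; in general the census's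
"positivity domain").  Outside that domain NOTHING is claimed here (the `3³` table rows of `TwistBoundThreeCube`
cover the whole admissible ray `K × C`).  Nothing here concerns (5.15), the thermodynamic limit, confinement or a
mass gap.  Inputs: `OddCrossingBound.crossIntegralO_nonneg` (RP with the shared block), the sector bookkeeping of
`CharacterTwistGram` / `TwistedSectorExpansion`, the plane symmetry of `VortexTwistPlaneSymmetry`, and the
transport of `MarkedPlaquetteTransport`.

## Main statements (namespace `Summit.Ventures.YMGap.Census`; hypotheses `Odd L`, `c_j ≥ 0`, `f_c ≥ 0`)

* `markedIntegral_nonneg_of_isOCrossPlaq`, `markedIntegral_nonneg_odd` (every plaquette).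
* `tSector_nonneg_odd`, `torusZtw_le_torusZ_odd` ((4.6)), `neg_torusZ_le_torusZtw_odd` ((4.7)),
  `abs_torusZtw_le_torusZ_odd` — twist sets of crossing plaquettes (`WilsonOddRP.IsOCrossPlaq`).
* `torusZtw_vortexSheet_le_torusZ_odd`, `abs_torusZtw_vortexSheet_le_torusZ_odd`, `abs_vortexRatio_le_one_plane_odd`
  — the vortex sheet in every plane; `abs_torusZtw_vortexSheet_le_torusZ_of_plaqFn_nonneg` — EVERY `L ≥ 2`
  (even: `CharacterTwistBound`, no positivity needed; odd: this file).

References: E. T. Tomboulis, arXiv:0707.2179, Prop. IV.1 eq. (4.6), §4.1 eq. (4.7), §2 (2.8), App. A §5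
[cite: Tomboulis2007Confinement, Prop. IV.1 eq. (4.6); §2 eq. (2.8)]; K. Osterwalder, E. Seiler, Ann. Phys. 110
(1978) 440, §2 [cite: OsterwalderSeilerAnnPhys1978, §2]; J. Fröhlich, R. Israel, E. H. Lieb, B. Simon, Comm. Math.
Phys. 62 (1978) 1, Thm. 2.1 [cite: FrohlichIsraelLiebSimon1978, Thm. 2.1].
-/

noncomputable section

open MeasureTheory Finset Real
open scoped BigOperators
open Literature.MathematicalPhysics.QuantumLattice
open Literature.MathematicalPhysics.QuantumFieldTheory
open Literature.MathematicalPhysics.QuantumFieldTheory.Tomboulis2007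
open Literature.MathematicalPhysics.QuantumFieldTheory.WilsonRP
open Literature.MathematicalPhysics.QuantumFieldTheory.WilsonOddRP
open Summit.Ventures.LatticeQCDFlow.Exactness

namespace Summit.Ventures.YMGap.Census

variable {d L : ℕ}

section ORP

variable [NeZero d] [NeZero L] [Fact (1 < L)]

/-! ### The marked-plaquette integral on the odd torus -/

omit [Fact (1 < L)] in
/-- For a crossing `p₀` of the odd torus and `k ≤ J` the marked integral is a `crossIntegralO`. -/
theorem markedIntegral_eq_crossIntegralO (J : ℕ) (c : ℕ → ℝ) {k : ℕ} (hkJ : k ≤ J) {p₀ : Plaquette d L}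
    (hp₀ : IsOCrossPlaq p₀) : markedIntegral J c k p₀ = crossIntegralO J c (markedCoef c k p₀) := by
  unfold markedIntegral crossIntegralO
  refine integral_congr_ae (ae_of_all _ fun W => Finset.prod_congr rfl fun p _ => ?_)
  by_cases hp : p = p₀
  · subst hp
    rw [if_pos rfl, crossWeightO, if_pos hp₀, markedCoef_self, charSum_singleCoef hkJ, su2Char_hol_eq_charR]
  · rw [if_neg hp, plaqFn_hol_eq_fR]
    unfold crossWeightO
    split_ifs with hpc
    · rw [markedCoef_of_ne c k hp, charSum_stdCoef]
    · rfl

/-- **The marked-plaquette integral is non-negative at a crossing plaquette of the odd torus**, for `c_j ≥ 0`,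
`f_c ≥ 0` pointwise and `k ≤ J`. -/
theorem markedIntegral_nonneg_of_isOCrossPlaq (hL : Odd L) (J : ℕ) {c : ℕ → ℝ} (hc : ∀ n, 1 ≤ n → 0 ≤ c n)
    (hf : ∀ U : SU2, 0 ≤ plaqFn J c U) {k : ℕ} (hkJ : k ≤ J) {p₀ : Plaquette d L} (hp₀ : IsOCrossPlaq p₀) :
    0 ≤ markedIntegral J c k p₀ := by
  rw [markedIntegral_eq_crossIntegralO J c hkJ hp₀]
  exact crossIntegralO_nonneg hL J hf fun p n => markedCoef_nonneg hc k p₀ p n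

/-- **The marked-plaquette integral is non-negative for EVERY plaquette of the odd torus** (`c_j ≥ 0`,
`f_c ≥ 0`, `k ≤ J`): transport to a crossing plaquette by an axis transposition and a translation
(`MarkedPlaquetteTransport`). -/
theorem markedIntegral_nonneg_odd (hL : Odd L) (J : ℕ) {c : ℕ → ℝ} (hc : ∀ n, 1 ≤ n → 0 ≤ c n)
    (hf : ∀ U : SU2, 0 ≤ plaqFn J c U) {k : ℕ} (hkJ : k ≤ J) (p₀ : Plaquette d L) :
    0 ≤ markedIntegral J c k p₀ := by
  obtain ⟨x, ⟨⟨i, j⟩, hij⟩⟩ := p₀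
  set q : Plaquette d L := plaqTranspose 0 i (x, ⟨(i, j), hij⟩) with hq
  have hij' : i < j := hij
  have hj0 : j ≠ 0 := fun h => by rw [h] at hij'; exact (Fin.not_lt_zero i) hij'
  have hji : j ≠ i := ne_of_gt hij'
  have hq1 : q.2.1.1 = 0 := by
    have hswi : Equiv.swap (0 : Fin d) i i = 0 := Equiv.swap_apply_right _ _
    have hswj : Equiv.swap (0 : Fin d) i j = j := Equiv.swap_apply_of_ne_of_ne hj0 hji
    have hlt : Equiv.swap (0 : Fin d) i i < Equiv.swap (0 : Fin d) i j := by
      rw [hswi, hswj]; exact lt_of_le_of_ne (Fin.zero_le _) (Ne.symm hj0)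
    have hdt : dirTranspose (0 : Fin d) i ⟨(i, j), hij⟩ =
        ⟨(Equiv.swap (0 : Fin d) i i, Equiv.swap (0 : Fin d) i j), hlt⟩ := by
      unfold dirTranspose
      rw [dif_pos hlt]
    rw [hq, plaqTranspose, hdt]
    exact hswi
  set r : Plaquette d L := plaqShift (-q.1) q with hr
  have hr_cross : IsOCrossPlaq r :=
    ⟨by simpa [hr, plaqShift] using hq1, by simp [hr, plaqShift]⟩
  have h1 : markedIntegral J c k (x, ⟨(i, j), hij⟩) = markedIntegral J c k q := by
    rw [hq, markedIntegral_plaqTranspose]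
  have h2 : markedIntegral J c k q = markedIntegral J c k r := by
    rw [hr, markedIntegral_shift]
  rw [h1, h2]
  exact markedIntegral_nonneg_of_isOCrossPlaq hL J hc hf hkJ hr_cross

/-! ### The twisted sectors and Prop. IV.1 on the odd torus -/

omit [NeZero L] [Fact (1 < L)] in
/-- For a twist set of crossing plaquettes the `Q`-sector weight configuration is a `crossWeightO` configuration
with the non-negative coefficients `coefA`. -/
theorem sectorWeight_eq_crossWeightO (J : ℕ) (c : ℕ → ℝ) {V Q : Finset (Plaquette d L)}
    (hV : ∀ p ∈ V, IsOCrossPlaq p) (hQ : Q ⊆ V) (p : Plaquette d L) (r : ℝ) :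
    sectorWeight J c V Q p r = crossWeightO J c (coefA c V Q) p r := by
  unfold crossWeightO
  split_ifs with hp
  · rfl
  · exact sectorWeight_of_not_mem J c hQ (fun h => hp (hV p h)) r

/-- **Reflection positivity of the twisted sectors on the odd torus**: for `L` odd, `c_j ≥ 0` (`j ≠ 0`), `f_c ≥ 0`
pointwise, a twist set `V` of crossing plaquettes and every `Q ⊆ V`, `0 ≤ tSector d L J c V Q`. -/
theorem tSector_nonneg_odd (hL : Odd L) (J : ℕ) {c : ℕ → ℝ} (hc : ∀ n, 1 ≤ n → 0 ≤ c n)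
    (hf : ∀ U : SU2, 0 ≤ plaqFn J c U) {V Q : Finset (Plaquette d L)} (hV : ∀ p ∈ V, IsOCrossPlaq p)
    (hQ : Q ⊆ V) : 0 ≤ tSector d L J c V Q := by
  have hT : tSector d L J c V Q = crossIntegralO J c (coefA c V Q) := by
    unfold tSector crossIntegralO
    refine integral_congr_ae (ae_of_all _ fun W => ?_)
    exact (tSector_integrand_eq_prod J c hQ W).trans
      (Finset.prod_congr rfl fun p _ => sectorWeight_eq_crossWeightO J c hV hQ p _)
  rw [hT]
  exact crossIntegralO_nonneg hL J hf fun p n => coefA_nonneg hc V Q p n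

/-- **Tomboulis's Prop. IV.1, eq. (4.6), on the odd torus** (positivity domain): `Z⁻_Λ(V) ≤ Z_Λ` for a twist set of
crossing plaquettes. -/
theorem torusZtw_le_torusZ_odd (hL : Odd L) (J : ℕ) {c : ℕ → ℝ} (hc : ∀ n, 1 ≤ n → 0 ≤ c n)
    (hf : ∀ U : SU2, 0 ≤ plaqFn J c U) {V : Finset (Plaquette d L)} (hV : ∀ p ∈ V, IsOCrossPlaq p) :
    torusZtw d L J c V ≤ torusZ d L J c :=
  (torusZtw_le_torusZ_iff_sum_nonneg d L J c V).2 (Finset.sum_nonneg fun _ hQ =>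
    tSector_nonneg_odd hL J hc hf hV (Finset.mem_powerset.1 (Finset.mem_filter.1 hQ).1))

/-- **`-Z_Λ ≤ Z⁻_Λ(V)` on the odd torus** (positivity domain; eq. (4.7)). -/
theorem neg_torusZ_le_torusZtw_odd (hL : Odd L) (J : ℕ) {c : ℕ → ℝ} (hc : ∀ n, 1 ≤ n → 0 ≤ c n)
    (hf : ∀ U : SU2, 0 ≤ plaqFn J c U) {V : Finset (Plaquette d L)} (hV : ∀ p ∈ V, IsOCrossPlaq p) :
    -torusZ d L J c ≤ torusZtw d L J c V := by
  have h := torusZ_add_torusZtw_eq_sum d L J c V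
  have h2 : 0 ≤ ∑ Q ∈ V.powerset.filter (fun Q => Even Q.card), tSector d L J c V Q :=
    Finset.sum_nonneg fun Q hQ =>
      tSector_nonneg_odd hL J hc hf hV (Finset.mem_powerset.1 (Finset.mem_filter.1 hQ).1)
  linarith

/-- **`|Z⁻_Λ(V)| ≤ Z_Λ` on the odd torus** (positivity domain). -/
theorem abs_torusZtw_le_torusZ_odd (hL : Odd L) (J : ℕ) {c : ℕ → ℝ} (hc : ∀ n, 1 ≤ n → 0 ≤ c n)
    (hf : ∀ U : SU2, 0 ≤ plaqFn J c U) {V : Finset (Plaquette d L)} (hV : ∀ p ∈ V, IsOCrossPlaq p) :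
    |torusZtw d L J c V| ≤ torusZ d L J c :=
  abs_le.2 ⟨by linarith [neg_torusZ_le_torusZtw_odd hL J hc hf hV], torusZtw_le_torusZ_odd hL J hc hf hV⟩

omit [Fact (1 < L)] in
/-- The vortex sheet of the `(0, j)` plane consists of crossing plaquettes of the odd torus. -/
theorem vortexSheet_isOCrossPlaq (j : Fin d) (h0j : (0 : Fin d) < j) :
    ∀ p ∈ vortexSheet L 0 j h0j, IsOCrossPlaq p := by
  intro p hp
  unfold vortexSheet at hp
  obtain ⟨h2, h0, -⟩ := (Finset.mem_filter.1 hp).2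
  exact ⟨by rw [h2], by rw [h0, ZMod.val_zero]⟩

/-- **`Z⁻_Λ(𝒱_{ij}) ≤ Z_Λ` for the vortex sheet in every plane, every spin cut-off, on the odd torus `(ℤ/Lℤ)^d`
(`d ≥ 2`)**, for `c_j ≥ 0` and `f_c ≥ 0` pointwise. -/
theorem torusZtw_vortexSheet_le_torusZ_odd (hL : Odd L) (h01 : (0 : Fin d) < 1) (J : ℕ) {c : ℕ → ℝ}
    (hc : ∀ n, 1 ≤ n → 0 ≤ c n) (hf : ∀ U : SU2, 0 ≤ plaqFn J c U) {i j : Fin d} (hij : i < j) :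
    torusZtw d L J c (vortexSheet L i j hij) ≤ torusZ d L J c := by
  rw [torusZtw_vortexSheet_eq_plane_zero_one h01 hij]
  exact torusZtw_le_torusZ_odd hL J hc hf (vortexSheet_isOCrossPlaq 1 h01)

/-- **`|Z⁻_Λ(𝒱_{ij})| ≤ Z_Λ` for every plane and every spin cut-off on the odd torus** (`c_j ≥ 0`, `f_c ≥ 0`). -/
theorem abs_torusZtw_vortexSheet_le_torusZ_odd (hL : Odd L) (h01 : (0 : Fin d) < 1) (J : ℕ) {c : ℕ → ℝ}
    (hc : ∀ n, 1 ≤ n → 0 ≤ c n) (hf : ∀ U : SU2, 0 ≤ plaqFn J c U) {i j : Fin d} (hij : i < j) :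
    |torusZtw d L J c (vortexSheet L i j hij)| ≤ torusZ d L J c := by
  rw [torusZtw_vortexSheet_eq_plane_zero_one h01 hij]
  exact abs_torusZtw_le_torusZ_odd hL J hc hf (vortexSheet_isOCrossPlaq 1 h01)

/-- **`|Z⁻_Λ/Z_Λ| ≤ 1` for the vortex sheet in every plane, every spin cut-off, on the odd torus** (`c_j ≥ 0`,
`f_c ≥ 0`, `Z_Λ ≠ 0`). -/
theorem abs_vortexRatio_le_one_plane_odd (hL : Odd L) (h01 : (0 : Fin d) < 1) (J : ℕ) {c : ℕ → ℝ}
    (hc : ∀ n, 1 ≤ n → 0 ≤ c n) (hf : ∀ U : SU2, 0 ≤ plaqFn J c U) {i j : Fin d} (hij : i < j)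
    (hZ : torusZ d L J c ≠ 0) : |vortexRatio d L J c (vortexSheet L i j hij)| ≤ 1 := by
  have hZpos : 0 < torusZ d L J c := by
    rcases ((abs_nonneg (torusZtw d L J c (vortexSheet L i j hij))).trans
        (abs_torusZtw_vortexSheet_le_torusZ_odd hL h01 J hc hf hij)).lt_or_eq with h | h
    · exact h
    · exact absurd h.symm hZ
  unfold vortexRatio
  rw [abs_div, abs_of_pos hZpos, div_le_one hZpos]
  exact abs_torusZtw_vortexSheet_le_torusZ_odd hL h01 J hc hf hij

/-- **`|Z⁻_Λ(𝒱_{ij})| ≤ Z_Λ` on EVERY symmetric torus `(ℤ/Lℤ)^d`, `L ≥ 2`, every plane, every spin cut-off**, for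
`c_j ≥ 0` and `f_c ≥ 0` pointwise (even `L`: `CharacterTwistBound.abs_torusZtw_vortexSheet_le_torusZ`, where the
positivity of `f_c` is not needed; odd `L`: this file). -/
theorem abs_torusZtw_vortexSheet_le_torusZ_of_plaqFn_nonneg (h01 : (0 : Fin d) < 1) (J : ℕ) {c : ℕ → ℝ}
    (hc : ∀ n, 1 ≤ n → 0 ≤ c n) (hf : ∀ U : SU2, 0 ≤ plaqFn J c U) {i j : Fin d} (hij : i < j) :
    |torusZtw d L J c (vortexSheet L i j hij)| ≤ torusZ d L J c := by
  rcases Nat.even_or_odd L with hL | hL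
  · exact abs_torusZtw_vortexSheet_le_torusZ hL h01 J hc hij
  · exact abs_torusZtw_vortexSheet_le_torusZ_odd hL h01 J hc hf hij

end ORP

end Summit.Ventures.YMGap.Census

end
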